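import Summits.QuantumFields.YangMills.Theorems.BalabanUVNodesPortS1RecordDtTrLog

/-!
# Port S1, socket (o3)-VII (docket (2)) — THE (o3) BRICKS AT THE PINNED k-UNIFORM RADIUS `ρ₀(d, L, α)`, ONE CURRENCY `dist1(loops) ≤ α`, `157α < L^{1−d}`
# (director-ym R702-ym docket (2): «`recordDt`-specialisations at ρ₀»; the letters (o1-ε) discharged as in ✓`recordDt_spec_uniform`)

Cell `ym-nodeO-ideate`, porter seat PT-A-1 (gen 10); `--kind proof --supports stmt-QuantumFields-27930 --as helper`; count-neutral.  [I] = [Balaban1987RG1]; [15] = [Balaban1985Variational].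
With `R = 1∕(10⁸dL)`, `C₂ = 2∕R²`, `b = 6∕(L^{1−d} − 157α)`, `ρ₀ = min (R∕3) (1∕(18C₂(b+1)))` (all written out), for every background `Vk` whose (0.4) loop variables satisfy `dist1 ≤ α`,
`157α < L^{1−d}` (⇒ `α ≤ 1∕50`, the guard, `‖h_ℂ‖ ≤ b` by ✓`norm_hopLinGraphC_le`, `9C₂bρ₀ < 1`, `3ρ₀ ≤ R` by ✓`recordDt_smallness_of_radius`):
* ★★★ `analyticOnNhd_recordDt_uniform` — `recordDt Vk ρ₀` is analytic on `ball 0 ρ₀` (✓`analyticOnNhd_recordDt_ball`);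
* ★★ `recordDt_ofReal_mem_lieSU_uniform` — `recordDt Vk ρ₀ ↑y c ∈ 𝔰𝔲(2)` for real `‖↑y‖ < ρ₀` (✓`recordDt_ofReal_mem_lieSU`);
* ★★ `recordDtCorrOf_recordDt_uniform` — DEF-1's `recordDtCorrOf F k (fun Vk => recordDt F k K Vk ρ₀) Vk y = hopLinGraph Vk (recordDt Vk ρ₀ ↑y)` (✓`recordDtCorrOf_recordDt`);
* ★★★ `recordDtJacOf_recordDt_uniform` — DEF-1's `recordDtJacOf F k (fun Vk => recordDt F k K Vk ρ₀) Vk g x = −log ‖det(1 + h_ℂ ∘L DC̃_ℂ(↑Y_g(x)))‖` for `‖↑(g•x)‖ < ρ₀` (✓`recordDtJacOf_recordDt`);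
* ★★★ `recordDtJacOf_recordDt_eq_neg_re_trace_logOnePlus_uniform` — `= −Re Tr logOnePlus(h_ℂ ∘L DC̃_ℂ(↑Y_g(x)))` (✓`recordDtJacOf_recordDt_eq_neg_re_trace_logOnePlus`);
* ★★ `analyticOnNhd_trace_logOnePlus_uniform` — `B′ ↦ Tr logOnePlus(h_ℂ ∘L DC̃_ℂ(B′))` analytic on `ball 0 (2ρ₀)` (✓`analyticOnNhd_trace_logOnePlus_hop_comp_fderiv_recordCtC`).

HONEST FRAMING.  One-line specialisations (letter discharge only); nothing of Bałaban's renormalization-group estimates asserted, ported or discharged beyond the cited bricks; `stub_FE` (XXL) ∕ `stub_P0C` OPEN,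
⟨27930⟩ OPEN (1∕3); NODE O 0∕1; COUNT 8∕28 · K 1∕4 UNMOVED; finite `𝕋⁴_{L^K}` at fixed ε — NOT continuum ∕ OS; **the Yang–Mills mass gap (Clay) is NOT proved by any of this.**  No `sorry`, no `def`,
no `instance`; standard axioms only.
-/

noncomputable section

open scoped BigOperators Matrix.Norms.L2Operator Topology

open Set Metric Filter

namespace Summit.QuantumFields.YangMills.Theorems.BalabanUVNodesPortS1

open Summit.QuantumFields.YangMills.Theorems.K0RecordFormatNames
open Literature.MathematicalPhysics.QuantumFieldTheory.Balaban1983to89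
open Literature.MathematicalPhysics.QuantumFieldTheory.Balaban1983to89.Node00
open Literature.MathematicalPhysics.QuantumFieldTheory.Balaban1983to89.T4Continuum (T4Family)
open Literature.MathematicalPhysics.QuantumFieldTheory.Balaban1983to89.T4AdjointCovarianceUnitary (lieSU)
open Literature.MathematicalPhysics.QuantumFieldTheory.Balaban1983to89.BlockAveraging (avgFun loopHol Small Idx)
open Literature.MathematicalPhysics.QuantumFieldTheory.Balaban1983to89.ExpMeanLog (expMeanLogSU)
open Literature.Analysis.Complex (logOnePlus)
open _root_.Matrix

variable {F : T4Family} {k K : ℕ}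

/-- ★★★ **`D̃ = recordDt Vk ρ₀` IS ANALYTIC ON `ball 0 ρ₀`** at the pinned k-uniform radius, in the `α`-currency. [cite: Balaban1987RG1, p.267 («an analytic function of B»); Balaban1985Variational, (96)–(98) p.292] -/
theorem analyticOnNhd_recordDt_uniform (hk : k + 1 ≤ (F.P K).m + (F.P K).K) (Vk : GaugeField (F.P K) k (SU 2)) {α : ℝ}
    (hα : ∀ (c : PBond (F.P K) (k + 1)) (i : Idx (F.P K)), dist1 (loopHol Vk c i) ≤ α) (hαL : 157 * α < (((F.P K).L : ℝ) ^ ((F.P K).d - 1))⁻¹) :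
    AnalyticOnNhd ℂ (recordDt F k K Vk (min ((1 : ℝ) / (10 ^ 8 * (F.P K).d * (F.P K).L) / 3) (1 / (18 * (2 * 1 / (1 / (10 ^ 8 * (F.P K).d * (F.P K).L)) ^ 2) * ((6 / ((((F.P K).L : ℝ) ^ ((F.P K).d - 1))⁻¹ - 157 * α)) + 1))))) (ball (0 : FluctIdx F k K → ℂ) (min ((1 : ℝ) / (10 ^ 8 * (F.P K).d * (F.P K).L) / 3) (1 / (18 * (2 * 1 / (1 / (10 ^ 8 * (F.P K).d * (F.P K).L)) ^ 2) * ((6 / ((((F.P K).L : ℝ) ^ ((F.P K).d - 1))⁻¹ - 157 * α)) + 1))))) := by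
  have hα50 : α ≤ 1 / 50 := alpha_le_fiftieth_of_lt F K hαL
  have hα24 : α ≤ 1 / 24 := hα50.trans (by norm_num)
  have hθ : 0 < (((F.P K).L : ℝ) ^ ((F.P K).d - 1))⁻¹ - 157 * α := sub_pos.2 hαL
  have hb : (0 : ℝ) ≤ 6 / ((((F.P K).L : ℝ) ^ ((F.P K).d - 1))⁻¹ - 157 * α) := by positivity
  have hd : (1 : ℝ) ≤ (F.P K).d := by exact_mod_cast (F.P K).hd
  have hL : (1 : ℝ) ≤ (F.P K).L := by exact_mod_cast (F.P K).hL.2.le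
  have hR : (0 : ℝ) < 1 / (10 ^ 8 * (F.P K).d * (F.P K).L) := by positivity
  have hC₂ : (0 : ℝ) < 2 * 1 / (1 / (10 ^ 8 * (F.P K).d * (F.P K).L)) ^ 2 := by positivity
  obtain ⟨_, hq, h3⟩ := recordDt_smallness_of_radius hR hC₂ hb
  exact analyticOnNhd_recordDt_ball hk Vk (norm_loopM_sub_one_le_of_dist1 F Vk hα) hα50 (small_of_dist1_le F Vk hα hα50) hb
    (norm_hopLinGraphC_le F k K hk Vk hα hα24 hαL) hq h3 

/-- ★★ **`D̃(↑y)` IS 𝔰𝔲(2)-VALUED** at the pinned radius: `recordDt Vk ρ₀ ↑y c ∈ 𝔰𝔲(2)` for real `y` with `‖↑y‖ < ρ₀`. [cite: Balaban1987RG1, p.267 («𝐠-valued function D̃»)] -/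
theorem recordDt_ofReal_mem_lieSU_uniform (hk : k + 1 ≤ (F.P K).m + (F.P K).K) (Vk : GaugeField (F.P K) k (SU 2)) {α : ℝ}
    (hα : ∀ (c : PBond (F.P K) (k + 1)) (i : Idx (F.P K)), dist1 (loopHol Vk c i) ≤ α) (hαL : 157 * α < (((F.P K).L : ℝ) ^ ((F.P K).d - 1))⁻¹)
    (y : FluctIdx F k K → ℝ) (hy : ‖(fun i => (y i : ℂ))‖ < (min ((1 : ℝ) / (10 ^ 8 * (F.P K).d * (F.P K).L) / 3) (1 / (18 * (2 * 1 / (1 / (10 ^ 8 * (F.P K).d * (F.P K).L)) ^ 2) * ((6 / ((((F.P K).L : ℝ) ^ ((F.P K).d - 1))⁻¹ - 157 * α)) + 1))))) (c : PBond (F.P K) (k + 1)) :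
    recordDt F k K Vk (min ((1 : ℝ) / (10 ^ 8 * (F.P K).d * (F.P K).L) / 3) (1 / (18 * (2 * 1 / (1 / (10 ^ 8 * (F.P K).d * (F.P K).L)) ^ 2) * ((6 / ((((F.P K).L : ℝ) ^ ((F.P K).d - 1))⁻¹ - 157 * α)) + 1)))) (fun i => (y i : ℂ)) c ∈ lieSU (Fin 2) := by
  have hα50 : α ≤ 1 / 50 := alpha_le_fiftieth_of_lt F K hαL
  have hα24 : α ≤ 1 / 24 := hα50.trans (by norm_num)
  have hθ : 0 < (((F.P K).L : ℝ) ^ ((F.P K).d - 1))⁻¹ - 157 * α := sub_pos.2 hαL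
  have hb : (0 : ℝ) ≤ 6 / ((((F.P K).L : ℝ) ^ ((F.P K).d - 1))⁻¹ - 157 * α) := by positivity
  have hd : (1 : ℝ) ≤ (F.P K).d := by exact_mod_cast (F.P K).hd
  have hL : (1 : ℝ) ≤ (F.P K).L := by exact_mod_cast (F.P K).hL.2.le
  have hR : (0 : ℝ) < 1 / (10 ^ 8 * (F.P K).d * (F.P K).L) := by positivity
  have hC₂ : (0 : ℝ) < 2 * 1 / (1 / (10 ^ 8 * (F.P K).d * (F.P K).L)) ^ 2 := by positivity
  obtain ⟨_, hq, h3⟩ := recordDt_smallness_of_radius hR hC₂ hb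
  exact recordDt_ofReal_mem_lieSU hk Vk (norm_loopM_sub_one_le_of_dist1 F Vk hα) hα50 (small_of_dist1_le F Vk hα hα50) hb
    (norm_hopLinGraphC_le F k K hk Vk hα hα24 hαL) hq h3 y hy c

/-- ★★ **DEF-1's `recordDtCorrOf` AT THE PINNED `recordDt` FAMILY IS `Re`-EXACT**: `= hopLinGraph Vk (recordDt Vk ρ₀ ↑y)` for `‖↑y‖ < ρ₀`. [cite: Balaban1987RG1, p.267 («B′ = B − hD̃(B)»)] -/
theorem recordDtCorrOf_recordDt_uniform (hk : k + 1 ≤ (F.P K).m + (F.P K).K) (Vk : GaugeField (F.P K) k (SU 2)) {α : ℝ}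
    (hα : ∀ (c : PBond (F.P K) (k + 1)) (i : Idx (F.P K)), dist1 (loopHol Vk c i) ≤ α) (hαL : 157 * α < (((F.P K).L : ℝ) ^ ((F.P K).d - 1))⁻¹)
    (y : FluctIdx F k K → ℝ) (hy : ‖(fun i => (y i : ℂ))‖ < (min ((1 : ℝ) / (10 ^ 8 * (F.P K).d * (F.P K).L) / 3) (1 / (18 * (2 * 1 / (1 / (10 ^ 8 * (F.P K).d * (F.P K).L)) ^ 2) * ((6 / ((((F.P K).L : ℝ) ^ ((F.P K).d - 1))⁻¹ - 157 * α)) + 1))))) :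
    recordDtCorrOf F k (fun Vk => recordDt F k K Vk (min ((1 : ℝ) / (10 ^ 8 * (F.P K).d * (F.P K).L) / 3) (1 / (18 * (2 * 1 / (1 / (10 ^ 8 * (F.P K).d * (F.P K).L)) ^ 2) * ((6 / ((((F.P K).L : ℝ) ^ ((F.P K).d - 1))⁻¹ - 157 * α)) + 1))))) Vk y =
      hopLinGraph F k K Vk (recordDt F k K Vk (min ((1 : ℝ) / (10 ^ 8 * (F.P K).d * (F.P K).L) / 3) (1 / (18 * (2 * 1 / (1 / (10 ^ 8 * (F.P K).d * (F.P K).L)) ^ 2) * ((6 / ((((F.P K).L : ℝ) ^ ((F.P K).d - 1))⁻¹ - 157 * α)) + 1)))) (fun i => (y i : ℂ))) := by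
  have hα50 : α ≤ 1 / 50 := alpha_le_fiftieth_of_lt F K hαL
  have hα24 : α ≤ 1 / 24 := hα50.trans (by norm_num)
  have hθ : 0 < (((F.P K).L : ℝ) ^ ((F.P K).d - 1))⁻¹ - 157 * α := sub_pos.2 hαL
  have hb : (0 : ℝ) ≤ 6 / ((((F.P K).L : ℝ) ^ ((F.P K).d - 1))⁻¹ - 157 * α) := by positivity
  have hd : (1 : ℝ) ≤ (F.P K).d := by exact_mod_cast (F.P K).hd
  have hL : (1 : ℝ) ≤ (F.P K).L := by exact_mod_cast (F.P K).hL.2.le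
  have hR : (0 : ℝ) < 1 / (10 ^ 8 * (F.P K).d * (F.P K).L) := by positivity
  have hC₂ : (0 : ℝ) < 2 * 1 / (1 / (10 ^ 8 * (F.P K).d * (F.P K).L)) ^ 2 := by positivity
  obtain ⟨_, hq, h3⟩ := recordDt_smallness_of_radius hR hC₂ hb
  exact recordDtCorrOf_recordDt hk Vk (norm_loopM_sub_one_le_of_dist1 F Vk hα) hα50 (small_of_dist1_le F Vk hα hα50) hb
    (norm_hopLinGraphC_le F k K hk Vk hα hα24 hαL) hq h3 y hy

/-- ★★★ **DEF-1's (o3) SOCKET AT THE PINNED `recordDt` FAMILY, EXPLICIT**: for `‖↑(g•x)‖ < ρ₀`,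
`recordDtJacOf F k (fun Vk => recordDt F k K Vk ρ₀) Vk g x = −Real.log ‖det(1 + h_ℂ ∘L DC̃_ℂ(↑Y_g(x)))‖`, `Y_g(x) = recordReparamOf F k (fun Vk => recordDt F k K Vk ρ₀) Vk g x`. [cite: Balaban1987RG1, (2.12) p.268] -/
theorem recordDtJacOf_recordDt_uniform (hk : k + 1 ≤ (F.P K).m + (F.P K).K) (Vk : GaugeField (F.P K) k (SU 2)) {α : ℝ}
    (hα : ∀ (c : PBond (F.P K) (k + 1)) (i : Idx (F.P K)), dist1 (loopHol Vk c i) ≤ α) (hαL : 157 * α < (((F.P K).L : ℝ) ^ ((F.P K).d - 1))⁻¹)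
    (g : ℝ) (x : FluctIdx F k K → ℝ) (hgx : ‖(fun i => ((g • x) i : ℂ))‖ < (min ((1 : ℝ) / (10 ^ 8 * (F.P K).d * (F.P K).L) / 3) (1 / (18 * (2 * 1 / (1 / (10 ^ 8 * (F.P K).d * (F.P K).L)) ^ 2) * ((6 / ((((F.P K).L : ℝ) ^ ((F.P K).d - 1))⁻¹ - 157 * α)) + 1))))) :
    recordDtJacOf F k (fun Vk => recordDt F k K Vk (min ((1 : ℝ) / (10 ^ 8 * (F.P K).d * (F.P K).L) / 3) (1 / (18 * (2 * 1 / (1 / (10 ^ 8 * (F.P K).d * (F.P K).L)) ^ 2) * ((6 / ((((F.P K).L : ℝ) ^ ((F.P K).d - 1))⁻¹ - 157 * α)) + 1))))) Vk g x =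
      -Real.log ‖LinearMap.det (((1 : (FluctIdx F k K → ℂ) →L[ℂ] (FluctIdx F k K → ℂ)) + (LinearMap.toContinuousLinearMap (hopLinGraphC F k K Vk)).comp (fderiv ℂ (recordCtC F k K Vk) (fun i => (((recordReparamOf F k (fun Vk => recordDt F k K Vk (min ((1 : ℝ) / (10 ^ 8 * (F.P K).d * (F.P K).L) / 3) (1 / (18 * (2 * 1 / (1 / (10 ^ 8 * (F.P K).d * (F.P K).L)) ^ 2) * ((6 / ((((F.P K).L : ℝ) ^ ((F.P K).d - 1))⁻¹ - 157 * α)) + 1))))) Vk g x)) i : ℂ))))).toLinearMap‖ := by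
  have hα50 : α ≤ 1 / 50 := alpha_le_fiftieth_of_lt F K hαL
  have hα24 : α ≤ 1 / 24 := hα50.trans (by norm_num)
  have hθ : 0 < (((F.P K).L : ℝ) ^ ((F.P K).d - 1))⁻¹ - 157 * α := sub_pos.2 hαL
  have hb : (0 : ℝ) ≤ 6 / ((((F.P K).L : ℝ) ^ ((F.P K).d - 1))⁻¹ - 157 * α) := by positivity
  have hd : (1 : ℝ) ≤ (F.P K).d := by exact_mod_cast (F.P K).hd
  have hL : (1 : ℝ) ≤ (F.P K).L := by exact_mod_cast (F.P K).hL.2.le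
  have hR : (0 : ℝ) < 1 / (10 ^ 8 * (F.P K).d * (F.P K).L) := by positivity
  have hC₂ : (0 : ℝ) < 2 * 1 / (1 / (10 ^ 8 * (F.P K).d * (F.P K).L)) ^ 2 := by positivity
  obtain ⟨_, hq, h3⟩ := recordDt_smallness_of_radius hR hC₂ hb
  exact recordDtJacOf_recordDt hk Vk (norm_loopM_sub_one_le_of_dist1 F Vk hα) hα50 (small_of_dist1_le F Vk hα hα50) hb
    (norm_hopLinGraphC_le F k K hk Vk hα hα24 hαL) hq h3 g x hgx

/-- ★★★ **… AND IN PRINT's `−Tr log` FORM**: for `‖↑(g•x)‖ < ρ₀`, `recordDtJacOf F k (fun Vk => recordDt F k K Vk ρ₀) Vk g x = −Re Tr logOnePlus(h_ℂ ∘L DC̃_ℂ(↑Y_g(x)))`.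
[cite: Balaban1987RG1, (2.12) p.268 («Tr log(I − h(δ∕δB)D̃)»)] -/
theorem recordDtJacOf_recordDt_eq_neg_re_trace_logOnePlus_uniform (hk : k + 1 ≤ (F.P K).m + (F.P K).K) (Vk : GaugeField (F.P K) k (SU 2)) {α : ℝ}
    (hα : ∀ (c : PBond (F.P K) (k + 1)) (i : Idx (F.P K)), dist1 (loopHol Vk c i) ≤ α) (hαL : 157 * α < (((F.P K).L : ℝ) ^ ((F.P K).d - 1))⁻¹)
    (g : ℝ) (x : FluctIdx F k K → ℝ) (hgx : ‖(fun i => ((g • x) i : ℂ))‖ < (min ((1 : ℝ) / (10 ^ 8 * (F.P K).d * (F.P K).L) / 3) (1 / (18 * (2 * 1 / (1 / (10 ^ 8 * (F.P K).d * (F.P K).L)) ^ 2) * ((6 / ((((F.P K).L : ℝ) ^ ((F.P K).d - 1))⁻¹ - 157 * α)) + 1))))) :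
    recordDtJacOf F k (fun Vk => recordDt F k K Vk (min ((1 : ℝ) / (10 ^ 8 * (F.P K).d * (F.P K).L) / 3) (1 / (18 * (2 * 1 / (1 / (10 ^ 8 * (F.P K).d * (F.P K).L)) ^ 2) * ((6 / ((((F.P K).L : ℝ) ^ ((F.P K).d - 1))⁻¹ - 157 * α)) + 1))))) Vk g x =
      -(LinearMap.trace ℂ (FluctIdx F k K → ℂ)
        (logOnePlus ((LinearMap.toContinuousLinearMap (hopLinGraphC F k K Vk)).comp (fderiv ℂ (recordCtC F k K Vk) (fun i => (((recordReparamOf F k (fun Vk => recordDt F k K Vk (min ((1 : ℝ) / (10 ^ 8 * (F.P K).d * (F.P K).L) / 3) (1 / (18 * (2 * 1 / (1 / (10 ^ 8 * (F.P K).d * (F.P K).L)) ^ 2) * ((6 / ((((F.P K).L : ℝ) ^ ((F.P K).d - 1))⁻¹ - 157 * α)) + 1))))) Vk g x)) i : ℂ))))).toLinearMap).re := by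
  have hα50 : α ≤ 1 / 50 := alpha_le_fiftieth_of_lt F K hαL
  have hα24 : α ≤ 1 / 24 := hα50.trans (by norm_num)
  have hθ : 0 < (((F.P K).L : ℝ) ^ ((F.P K).d - 1))⁻¹ - 157 * α := sub_pos.2 hαL
  have hb : (0 : ℝ) ≤ 6 / ((((F.P K).L : ℝ) ^ ((F.P K).d - 1))⁻¹ - 157 * α) := by positivity
  have hd : (1 : ℝ) ≤ (F.P K).d := by exact_mod_cast (F.P K).hd
  have hL : (1 : ℝ) ≤ (F.P K).L := by exact_mod_cast (F.P K).hL.2.le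
  have hR : (0 : ℝ) < 1 / (10 ^ 8 * (F.P K).d * (F.P K).L) := by positivity
  have hC₂ : (0 : ℝ) < 2 * 1 / (1 / (10 ^ 8 * (F.P K).d * (F.P K).L)) ^ 2 := by positivity
  obtain ⟨_, hq, h3⟩ := recordDt_smallness_of_radius hR hC₂ hb
  exact recordDtJacOf_recordDt_eq_neg_re_trace_logOnePlus hk Vk (norm_loopM_sub_one_le_of_dist1 F Vk hα) hα50 (small_of_dist1_le F Vk hα hα50) hb
    (norm_hopLinGraphC_le F k K hk Vk hα hα24 hαL) hq h3 g x hgx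

/-- ★★ **THE `Tr log` JACOBIAN IS ANALYTIC IN `B′` ON `ball 0 (2ρ₀)`** at the pinned radius. [cite: Balaban1987RG1, (2.12) p.268, (1.18) p.263] -/
theorem analyticOnNhd_trace_logOnePlus_uniform (hk : k + 1 ≤ (F.P K).m + (F.P K).K) (Vk : GaugeField (F.P K) k (SU 2)) {α : ℝ}
    (hα : ∀ (c : PBond (F.P K) (k + 1)) (i : Idx (F.P K)), dist1 (loopHol Vk c i) ≤ α) (hαL : 157 * α < (((F.P K).L : ℝ) ^ ((F.P K).d - 1))⁻¹) :
    AnalyticOnNhd ℂ (fun Y : FluctIdx F k K → ℂ => LinearMap.trace ℂ (FluctIdx F k K → ℂ)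
        (logOnePlus ((LinearMap.toContinuousLinearMap (hopLinGraphC F k K Vk)).comp (fderiv ℂ (recordCtC F k K Vk) Y))).toLinearMap)
      (ball (0 : FluctIdx F k K → ℂ) (2 * (min ((1 : ℝ) / (10 ^ 8 * (F.P K).d * (F.P K).L) / 3) (1 / (18 * (2 * 1 / (1 / (10 ^ 8 * (F.P K).d * (F.P K).L)) ^ 2) * ((6 / ((((F.P K).L : ℝ) ^ ((F.P K).d - 1))⁻¹ - 157 * α)) + 1)))))) := by
  have hα50 : α ≤ 1 / 50 := alpha_le_fiftieth_of_lt F K hαL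
  have hα24 : α ≤ 1 / 24 := hα50.trans (by norm_num)
  have hθ : 0 < (((F.P K).L : ℝ) ^ ((F.P K).d - 1))⁻¹ - 157 * α := sub_pos.2 hαL
  have hb : (0 : ℝ) ≤ 6 / ((((F.P K).L : ℝ) ^ ((F.P K).d - 1))⁻¹ - 157 * α) := by positivity
  have hd : (1 : ℝ) ≤ (F.P K).d := by exact_mod_cast (F.P K).hd
  have hL : (1 : ℝ) ≤ (F.P K).L := by exact_mod_cast (F.P K).hL.2.le
  have hR : (0 : ℝ) < 1 / (10 ^ 8 * (F.P K).d * (F.P K).L) := by positivity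
  have hC₂ : (0 : ℝ) < 2 * 1 / (1 / (10 ^ 8 * (F.P K).d * (F.P K).L)) ^ 2 := by positivity
  obtain ⟨_, hq, h3⟩ := recordDt_smallness_of_radius hR hC₂ hb
  exact analyticOnNhd_trace_logOnePlus_hop_comp_fderiv_recordCtC hk Vk (norm_loopM_sub_one_le_of_dist1 F Vk hα) hα50 (small_of_dist1_le F Vk hα hα50) hb
    (norm_hopLinGraphC_le F k K hk Vk hα hα24 hαL) hq h3 

end Summit.QuantumFields.YangMills.Theorems.BalabanUVNodesPortS1

end
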